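import Literature.AlgebraicGeometry.GroupSchemes.PowerLiftFpqcDescent
import Literature.AlgebraicGeometry.GroupSchemes.BarsottiTateGroupCanonicalLift
import Literature.AlgebraicGeometry.GroupSchemes.KernelOfLiftedMultipleKilledBySquare
import Literature.AlgebraicGeometry.GroupSchemes.GroupSchemeBaseChangeSquarePoints
import Literature.AlgebraicGeometry.GroupSchemes.BarsottiTateGroupTorsionLayers
import Literature.AlgebraicGeometry.AbelianSchemes.PDivisibleGroupOfAbelianScheme
import Literature.AlgebraicGeometry.AbelianSchemes.AbelianSchemeOverZariskiGluingDatum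
import HarnessLib

/-!
# Serre–Tate, σ2: the homomorphism «`p` × any LOCAL lift», `δ₂ : Y[p²] → B[p²]`, from local lifts on a finite flat cover
# ([Katz1981SerreTate] §1.1 Lemmas 1.1.2–1.1.3, §1.2 proof of Thm. 1.2.1; fpqc-local edition)

Layer `Literature/AlgebraicGeometry/GroupSchemes`, namespace `Literature.AlgebraicGeometry.GroupSchemes.SerreTateKernel`.
THEOREMS ONLY (no definition, no named fact, no instance, no notation, no `sorry`).

The «(s2) assembly» of the cell's Serre–Tate σ2 line (P6b wave A seat B6), DRESSED for the consumer: in the σ2 data (`p` nilpotent in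
the Artinian local `A`, `𝔪·J = 0`, `X₀ ∕ (A⧸J)` abelian with `B₀ = X₀[p^∞]` (`i₀`), `B ∕ A` a Barsotti–Tate group reducing to `B₀` (`c`), `Y ∕ A`
abelian reducing to `X₀` (`GY`), a `β`-tower `β n : B[pⁿ] → Y` of homomorphisms lifting `p · i₀ n`), given the reduction map
`j : X₀[p²] → Y[p²]` with its cartesian square and a kernel comparison `e : X₀[p²] → B₀[p²]` (`e ≫ i₀ 2 = ι`), and given — AS A
HYPOTHESIS, the «spine» of the (s2) road — ONE finite flat surjective cover `V → Y[p²]` carrying ONE lift `F : V → B[p^m]` of the point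
`e ≫ c 2` (transported into `B[p^m]`), there is `δ₂ : Y[p²] → B[p²]` over `A` with

  `δ₂ ≫ β 2 = 1`  and  `j ≫ δ₂ = e ^ p ≫ c 2` (on underlying schemes),

i.e. exactly the «δ₂-datum» consumed by ★ `SerreTateKernelFlatCover` (KF2-core).  ROAD ([Katz1981SerreTate] pp. 139–142 with Drinfeld's
rigidity in place of formal Lie theory, and fpqc descent in place of a global lift): `F ^ {p²}` is the unit modulo `J` (`B[p²]` is killed by
`p²`), so `F ^ {p³} = 1` (★ `ReductionKernel.pow_eq_one_of_isPullback` on the cover's reduction square); `F ^ p` descends along the cover (★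
`PowerLiftDescent.existsUnique_desc_pow_of_localLift`) to `δ_m : Y[p²] → B[p^m]`, killed by `p²`, hence through `B[p²]` (★
`BTGroup.existsUnique_fac_transition`); its reduction is `(e ≫ c 2) ^ p` (checked after the fpqc cover `V ×_{Y[p²]} X₀[p²] → X₀[p²]`); and
`β m ∘ F`, `ι ^ p : Y[p²] → Y` are two local lifts of `p · ι₀`, so their `p`-th powers agree (★ `PowerLiftDescent.pow_comp_eq_pow_comp_of_localLifts`
for the abelian scheme `Y`), giving `δ₂ ≫ β 2 = ι ^ {p²} = 1` after cancelling the cover.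

Cell `pub/hodgecm-mathlib`, P6b wave A seat B6 (LA3-p03 (g8); desk F0P6b-plan (g13) DEALS v5∕v6; δ₂-datum block of A6 F0P2-p01 (g30)
`DATUM-delta2.block.v1` 0ac3d8e8; spine hypothesis = B4 F0P3b-p01 (g27)'s HEAD at `T = Y[p²]`).  Generic∕count-neutral capital
`--supports stmt-HodgeConjecture-24832`; HC_CM is proved only modulo the printed citations until rung 0 closes.

## References
* [Katz1981SerreTate] N. M. Katz, *Serre–Tate local moduli*, LNM 868 (1981), §1.1 Lemmas 1.1.2–1.1.3 (pp. 138–141), §1.2 proof of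
  Theorem 1.2.1 (pp. 141–142).
* [GortzWedhorn2020] U. Görtz, T. Wedhorn, *Algebraic Geometry I*, 2nd ed. (2020), Thm. 14.72 (fpqc descent of morphisms).
* [Tate1967] J. Tate, *p-divisible groups* (Driebergen 1966), Springer 1967, §2 (2.1).
-/

set_option backward.isDefEq.respectTransparency false

noncomputable section

universe u

open CategoryTheory CategoryTheory.Limits AlgebraicGeometry MonoidalCategory CartesianMonoidalCategory IsLocalRing
open scoped MonObj

namespace Literature.AlgebraicGeometry.GroupSchemes

namespace SerreTateKernel

open Literature.AlgebraicGeometry.AbelianSchemes Literature.AlgebraicGeometry.Motives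

/-- **THE δ₂-DATUM FROM ONE LOCAL LIFT** ([Katz1981SerreTate] §1.1 Lemma 1.1.3 (3) «`p` × any lift», fpqc-locally; §1.2 proof of
Theorem 1.2.1).  SETTING: the σ2 data (binders verbatim as in ★ `SerreTateKernelFlatCover`), the reduction map `j : X₀[p²] → Y[p²]` over
`GY` WITH its cartesian square over `Spec (A⧸J) ↪ Spec A`, a kernel comparison `e : X₀[p²] → B₀[p²]` (`e ≫ i₀ 2 = ι`), and the SPINE
HYPOTHESIS (the unit-component road — VERBATIM the conclusion of ★ `BTGroup.exists_finiteFlat_cover_lift` at `T = Y[p²]`, `n = 2`): for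
every cartesian reduction square `(ρ, b)` of `Y[p²]` and every point `u₀ : Y[p²]₀ → B[p²]` over `Y[p²]` there are an affine `V`, a finite flat
surjective `cV : V → Y[p²]`, an `m ≥ 2` and a lift
`F : V → B[p^m]` of `u₀ ≫ (B[p²] ↪ B[p^m])` (`F ∣_{V ×_{Y[p²]} Y[p²]₀} = (u₀ ≫ transition) ∘ pr₂`).  CONCLUSION: there is
`δ₂ : Y[p²] → B[p²]` over `A` with `δ₂ ≫ β 2 = 1` and `j ≫ δ₂ = e ^ p ≫ c 2` on underlying schemes.
[cite: Katz1981SerreTate, §1.1 Lemmas 1.1.2–1.1.3 (pp. 138–141) and §1.2 proof of Theorem 1.2.1 (pp. 141–142)]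
[cite: GortzWedhorn2020, Thm. 14.72] [cite: Tate1967, §2 (2.1)] -/
theorem exists_delta2_of_localLift :
    ∀ (p : ℕ), p.Prime → ∀ (A : Type u) [CommRing A] [IsArtinianRing A] [IsLocalRing A], IsNilpotent (p : A) →
      ∀ (J : Ideal A), J ≠ ⊤ → maximalIdeal A * J = ⊥ →
      ∀ (g : ℕ) (X₀ : AbelianSchemeOver (Spec (.of (A ⧸ J)))), X₀.IsOfRelDim g →
      ∀ (B₀ : BTGroup (Spec (.of (A ⧸ J))) p (2 * g)) (i₀ : ∀ n, B₀.G n ⟶ X₀.X),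
        ((∀ n, letI := B₀.grpObj n; IsMonHom (i₀ n)) ∧
          (∀ n, IsPullback (i₀ n) (toUnit (B₀.G n)) (((𝟙 X₀.X : X₀.X ⟶ X₀.X) ^ (p ^ n) : X₀.X ⟶ X₀.X)) η[X₀.X]) ∧
          (∀ n, B₀.incl n ≫ i₀ (n + 1) = i₀ n)) →
      ∀ (B : BTGroup (Spec (.of A)) p (2 * g)) (c : ∀ n, (B₀.G n).left ⟶ (B.G n).left),
        B₀.IsBaseChangeVia B (Spec.map (CommRingCat.ofHom (Ideal.Quotient.mk J))) c →
      ∀ (Y : AbelianSchemeOver (Spec (.of A))), Y.IsOfRelDim g → ∀ (GY : X₀.X.left ⟶ Y.X.left),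
        X₀.IsBaseChangeVia Y (Spec.map (CommRingCat.ofHom (Ideal.Quotient.mk J))) GY →
      ∀ (β : ∀ n, B.G n ⟶ Y.X), (∀ n, letI := B.grpObj n; IsMonHom (β n)) → (∀ n, B.incl n ≫ β (n + 1) = β n) →
        (∀ n, c n ≫ (β n).left = ((i₀ n) ^ p).left ≫ GY) →
      ∀ (K : Over (Spec (.of A))) (iK : K ⟶ B.G 2), IsClosedImmersion iK.left → IsFinite K.hom →
        (∀ (T : Over (Spec (.of A))) (u : T ⟶ B.G 2), u ≫ β 2 = 1 ↔ ∃ v : T ⟶ K, v ≫ iK = u) →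
      ∀ (j : Over.mk ((X₀.torsion (p ^ 2)).hom ≫ Spec.map (CommRingCat.ofHom (Ideal.Quotient.mk J))) ⟶ Y.torsion (p ^ 2)),
        j.left ≫ (Y.torsionι (p ^ 2)).left = (X₀.torsionι (p ^ 2)).left ≫ GY →
        IsPullback j.left (X₀.torsion (p ^ 2)).hom (Y.torsion (p ^ 2)).hom
          (Spec.map (CommRingCat.ofHom (Ideal.Quotient.mk J))) →
      ∀ (e : X₀.torsion (p ^ 2) ⟶ B₀.G 2), e ≫ i₀ 2 = X₀.torsionι (p ^ 2) →
      -- the SPINE hypothesis (B4's head at `T = Y[p²]`, `n = 2`): ONE local lift on ONE finite flat surjective cover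
      (∀ (T₀ : Scheme.{u}) (ρ : T₀ ⟶ (Y.torsion (p ^ 2)).left) (b : T₀ ⟶ Spec (.of (A ⧸ J))),
          IsPullback ρ b (Y.torsion (p ^ 2)).hom (Spec.map (CommRingCat.ofHom (Ideal.Quotient.mk J))) →
          ∀ (u₀ : T₀ ⟶ (B.G 2).left), u₀ ≫ B.hom 2 = ρ ≫ (Y.torsion (p ^ 2)).hom →
          ∃ (V : Over (Spec (.of A))) (cV : V ⟶ Y.torsion (p ^ 2)),
            IsAffine V.left ∧ IsFinite cV.left ∧ Flat cV.left ∧ Surjective cV.left ∧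
            ∃ (m : ℕ) (hm : 2 ≤ m) (F : V ⟶ B.G m),
              pullback.fst cV.left ρ ≫ F.left = pullback.snd cV.left ρ ≫ u₀ ≫ (B.transition hm).left) →
      ∃ δ₂ : Y.torsion (p ^ 2) ⟶ B.G 2,
        δ₂ ≫ β 2 = 1 ∧ j.left ≫ δ₂.left = (letI := B₀.grpObj 2; (e ^ p).left) ≫ c 2 := by
  intro p hp A _ _ _ hpA J hJ hmJ g X₀ _ B₀ i₀ hT B c hBc Y _ GY hGY β hβ₁ hβ₂ hβ₃ _ _ _ _ _ j hj hjc e he hlift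
  obtain ⟨hi₀m, -, -⟩ := hT
  letI : ∀ k, GrpObj (B.G k) := B.grpObj
  letI : ∀ k, GrpObj (B₀.G k) := B₀.grpObj
  haveI : ∀ k, IsCommMonObj (B.G k) := B.comm
  haveI : IsCommMonObj Y.X := Y.isCommMonObj_of_isLocallyNoetherian_base
  haveI := hi₀m 2
  haveI := hβ₁
  -- arithmetic of the small extension: `J² = 0`, `p · J = 0`
  have hJJ : J * J = ⊥ := le_bot_iff.mp (hmJ ▸ Ideal.mul_mono_left (IsLocalRing.le_maximalIdeal hJ))
  have hpJ : ∀ a ∈ J, (p : A) * a = 0 :=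
    ReductionKernel.natCast_mul_eq_zero_of_isNilpotent_of_maximalIdeal_mul_eq_bot hpA hmJ
  obtain ⟨wB2, hcB2, hcη2, hcμ2⟩ := hBc.1 2
  -- §A THE POINT TO LIFT `t2 = e ≫ c 2 : X₀[p²] → B[p²]` over `Spec A`
  let t2 : Over.mk ((X₀.torsion (p ^ 2)).hom ≫ Spec.map (CommRingCat.ofHom (Ideal.Quotient.mk J))) ⟶ B.G 2 :=
    Over.homMk (e.left ≫ c 2) (by
      change (e.left ≫ c 2) ≫ (B.G 2).hom = (X₀.torsion (p ^ 2)).hom ≫ _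
      rw [Category.assoc, wB2, ← Category.assoc, Over.w e])
  -- §B THE SPINE: ONE lift `F : V → B[p^m]` of `t2 ≫ transition` on ONE finite flat surjective cover `cV : V → Y[p²]`
  have wj : j.left ≫ (Y.torsion (p ^ 2)).hom = (X₀.torsion (p ^ 2)).hom ≫ Spec.map (CommRingCat.ofHom (Ideal.Quotient.mk J)) :=
    Over.w j
  obtain ⟨V, cV, -, hfin, hflat, hsurj, m, h2m, F, hF⟩ := hlift _ j.left (X₀.torsion (p ^ 2)).hom hjc (e.left ≫ c 2) (by
    change (e.left ≫ c 2) ≫ (B.G 2).hom = j.left ≫ (Y.torsion (p ^ 2)).hom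
    rw [wj, Category.assoc, wB2, ← Category.assoc, Over.w e])
  haveI : IsFinite cV.left := hfin
  haveI : Flat cV.left := hflat
  haveI : Surjective cV.left := hsurj
  haveI : QuasiCompact cV.left := inferInstance
  haveI := B.isMonHom_transition h2m
  have hF' : pullback.fst cV.left j.left ≫ F.left = pullback.snd cV.left j.left ≫ (t2 ≫ B.transition h2m).left := by
    rw [Over.comp_left]
    exact hF
  -- the cover's reduction square `V₀ := V ×_{Y[p²]} X₀[p²]`, cartesian over `Spec (A⧸J) ↪ Spec A`, and its two projections over `Spec A`
  have hVsq : IsPullback (pullback.fst cV.left j.left) (pullback.snd cV.left j.left ≫ (X₀.torsion (p ^ 2)).hom) V.hom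
      (Spec.map (CommRingCat.ofHom (Ideal.Quotient.mk J))) := by
    rw [← Over.w cV]
    exact (IsPullback.of_hasPullback cV.left j.left).paste_vert hjc
  have hw₀ : pullback.snd cV.left j.left ≫ ((X₀.torsion (p ^ 2)).hom ≫ Spec.map (CommRingCat.ofHom (Ideal.Quotient.mk J))) =
      pullback.fst cV.left j.left ≫ V.hom :=
    calc pullback.snd cV.left j.left ≫ ((X₀.torsion (p ^ 2)).hom ≫ Spec.map (CommRingCat.ofHom (Ideal.Quotient.mk J)))
        = pullback.snd cV.left j.left ≫ (j.left ≫ (Y.torsion (p ^ 2)).hom) := by rw [wj]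
      _ = (pullback.fst cV.left j.left ≫ cV.left) ≫ (Y.torsion (p ^ 2)).hom := by rw [← Category.assoc, pullback.condition]
      _ = pullback.fst cV.left j.left ≫ V.hom := by rw [Category.assoc, Over.w cV]
  let q₁ : Over.mk (pullback.fst cV.left j.left ≫ V.hom) ⟶ V := Over.homMk (pullback.fst cV.left j.left) rfl
  let c₀ : Over.mk (pullback.fst cV.left j.left ≫ V.hom) ⟶
      Over.mk ((X₀.torsion (p ^ 2)).hom ≫ Spec.map (CommRingCat.ofHom (Ideal.Quotient.mk J))) :=
    Over.homMk (pullback.snd cV.left j.left) hw₀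
  have hq₁F : q₁ ≫ F = c₀ ≫ (t2 ≫ B.transition h2m) := Over.OverMorphism.ext hF'
  have hc₀j : c₀ ≫ j = q₁ ≫ cV := Over.OverMorphism.ext pullback.condition.symm
  -- §C `F^{p²}` IS THE UNIT MODULO `J` (`B[p²]` is killed by `p²`), HENCE `F^{p³} = 1` (Drinfeld's rigidity for `B[p^m]` on `V₀ ↪ V`)
  have hFp2 : pullback.fst cV.left j.left ≫ (F ^ (p ^ 2)).left = pullback.fst cV.left j.left ≫ (1 : V ⟶ B.G m).left := by
    have h : q₁ ≫ F ^ (p ^ 2) = q₁ ≫ 1 := by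
      rw [MonObj.comp_pow F (p ^ 2) q₁, hq₁F, ← MonObj.comp_pow, B.comp_transition_pow_eq_one h2m, MonObj.comp_one,
        MonObj.comp_one]
    have h' := congrArg Over.Hom.left h
    rw [Over.comp_left, Over.comp_left] at h'
    exact h'
  have hFp3 : (F ^ (p ^ 2)) ^ p = 1 :=
    ReductionKernel.pow_eq_one_of_isPullback hJJ hpJ (pullback.fst cV.left j.left)
      (pullback.snd cV.left j.left ≫ (X₀.torsion (p ^ 2)).hom) hVsq (F ^ (p ^ 2)) hFp2
  -- §D `F^p` DESCENDS along the cover to `δm : Y[p²] → B[p^m]` (★ `PowerLiftDescent`), and `δm` is killed by `p²`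
  obtain ⟨δm, hδm, -⟩ := PowerLiftDescent.existsUnique_desc_pow_of_localLift (G := B.G m) (N := p) hJJ hpJ j.left
    (X₀.torsion (p ^ 2)).hom hjc (t2 ≫ B.transition h2m).left cV F hF'
  have hδmp2 : δm ^ (p ^ 2) = 1 := by
    have h : cV ≫ δm ^ (p ^ 2) = cV ≫ 1 := by
      rw [MonObj.comp_pow δm (p ^ 2) cV, hδm, ← pow_mul, pow_mul', hFp3, MonObj.comp_one]
    apply Over.OverMorphism.ext
    exact Literature.AlgebraicGeometry.Morphisms.hom_ext_of_fpqc cV.left (by rw [← Over.comp_left, ← Over.comp_left, h])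
  -- §E `δ₂ := δm` CO-RESTRICTED TO `B[p²] = B[p^m][p²]` ([Tate1967] (2.1), ★ `existsUnique_fac_transition`)
  obtain ⟨δ₂, hδ₂, -⟩ := B.existsUnique_fac_transition h2m δm hδmp2
  -- §F THE REDUCTION OF `δ₂`: `j ≫ δ₂ = t2 ^ p` (checked after the fpqc cover `V₀ → X₀[p²]`, then `transition` cancelled)
  have hjδm : j ≫ δm = (t2 ≫ B.transition h2m) ^ p := by
    have h : c₀ ≫ (j ≫ δm) = c₀ ≫ (t2 ≫ B.transition h2m) ^ p := by
      rw [← Category.assoc, hc₀j, Category.assoc, hδm, MonObj.comp_pow F p q₁, hq₁F, ← MonObj.comp_pow]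
    apply Over.OverMorphism.ext
    refine Literature.AlgebraicGeometry.Morphisms.hom_ext_of_fpqc (pullback.snd cV.left j.left) ?_
    have h' := congrArg Over.Hom.left h
    rw [Over.comp_left, Over.comp_left] at h'
    exact h'
  have hjδ₂ : j ≫ δ₂ = t2 ^ p := by
    apply B.transition_comp_injective h2m
    change (j ≫ δ₂) ≫ B.transition h2m = (t2 ^ p) ≫ B.transition h2m
    rw [Category.assoc, hδ₂, hjδm, MonObj.pow_comp]
  -- §G `β 2 ∘ δ₂ = 1`: `β m ∘ F` (on `V`) and `ι^p` (on `Y[p²]`) are two local lifts of `p · ι₀`, so their `p`-th powers agree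
  have htrβ : ∀ {n n' : ℕ} (hnn' : n ≤ n'), B.transition hnn' ≫ β n' = β n := by
    intro n n' hnn'
    induction n', hnn' using Nat.le_induction with
    | base => rw [B.transition_self, Category.id_comp]
    | succ n' hnn' ih => rw [B.transition_succ_right hnn', Category.assoc, hβ₂, ih]
  have hpush : j ≫ Y.torsionι (p ^ 2) = hGY.pushHom (X₀.torsionι (p ^ 2)) := by
    apply Over.OverMorphism.ext
    rw [Over.comp_left, AbelianSchemeOver.IsBaseChangeVia.pushHom_left, hj]
  have hjι : j.left ≫ ((Y.torsionι (p ^ 2)) ^ p).left = ((X₀.torsionι (p ^ 2)) ^ p).left ≫ GY := by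
    have hpow : (hGY.pushHom (X₀.torsionι (p ^ 2))) ^ p = hGY.pushHom ((X₀.torsionι (p ^ 2)) ^ p) :=
      (map_pow (MonoidHom.mk' hGY.pushHom hGY.pushHom_mul) _ p).symm
    rw [← Over.comp_left, MonObj.comp_pow, hpush, hpow, AbelianSchemeOver.IsBaseChangeVia.pushHom_left]
  have ht2β : (t2 ≫ B.transition h2m ≫ β m).left = ((X₀.torsionι (p ^ 2)) ^ p).left ≫ GY := by
    rw [htrβ h2m, Over.comp_left]
    change (e.left ≫ c 2) ≫ (β 2).left = _
    rw [Category.assoc, hβ₃ 2, ← Category.assoc, ← Over.comp_left, MonObj.comp_pow, he]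
  have hagree₁ : pullback.fst cV.left j.left ≫ (F ≫ β m).left =
      pullback.snd cV.left j.left ≫ (((X₀.torsionι (p ^ 2)) ^ p).left ≫ GY) := by
    rw [Over.comp_left, ← Category.assoc, hF', Category.assoc, ← Over.comp_left, Category.assoc, ht2β]
  have hagree₂ : pullback.fst (𝟙 (Y.torsion (p ^ 2)) : Y.torsion (p ^ 2) ⟶ _).left j.left ≫ ((Y.torsionι (p ^ 2)) ^ p).left =
      pullback.snd (𝟙 (Y.torsion (p ^ 2)) : Y.torsion (p ^ 2) ⟶ _).left j.left ≫ (((X₀.torsionι (p ^ 2)) ^ p).left ≫ GY) := by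
    rw [← hjι, ← Category.assoc, ← pullback.condition (f := (𝟙 (Y.torsion (p ^ 2)) : Y.torsion (p ^ 2) ⟶ _).left)
      (g := j.left), Over.id_left, Category.comp_id]
  have hβδ : δ₂ ≫ β 2 = 1 := by
    have h1 : (𝟙 V ≫ (F ≫ β m)) ^ p = (cV ≫ (Y.torsionι (p ^ 2)) ^ p) ^ p :=
      PowerLiftDescent.pow_comp_eq_pow_comp_of_localLifts (G := Y.X) hJJ hpJ j.left (X₀.torsion (p ^ 2)).hom hjc
        (((X₀.torsionι (p ^ 2)) ^ p).left ≫ GY) cV (𝟙 _) (F ≫ β m) ((Y.torsionι (p ^ 2)) ^ p) hagree₁ hagree₂ (𝟙 V) cV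
        (by rw [Category.id_comp, Category.comp_id])
    have hιp : (cV ≫ (Y.torsionι (p ^ 2)) ^ p) ^ p = 1 := by
      rw [← MonObj.comp_pow, ← pow_mul, ← pow_two, ← AbelianSchemeOver.comp_mulN, AbelianSchemeOver.torsionι_comp_mulN,
        MonObj.comp_one]
    have h1' : (F ≫ β m) ^ p = 1 := by
      rw [← hιp, ← h1, Category.id_comp]
    -- `cV ≫ δm ≫ β m = (F ≫ β m)^p = 1`; cancel the fpqc cover, then `δ₂ ≫ β 2 = δ₂ ≫ transition ≫ β m = δm ≫ β m`
    have h2 : cV ≫ (δm ≫ β m) = cV ≫ 1 :=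
      calc cV ≫ (δm ≫ β m) = (cV ≫ δm) ≫ β m := (Category.assoc _ _ _).symm
        _ = (F ^ p) ≫ β m := congrArg (· ≫ β m) hδm
        _ = (F ≫ β m) ^ p := MonObj.pow_comp F p (β m)
        _ = 1 := h1'
        _ = cV ≫ 1 := (MonObj.comp_one cV).symm
    have h3 : δm ≫ β m = 1 := by
      apply Over.OverMorphism.ext
      exact Literature.AlgebraicGeometry.Morphisms.hom_ext_of_fpqc cV.left (by rw [← Over.comp_left, ← Over.comp_left, h2])
    rw [← htrβ h2m, ← Category.assoc, hδ₂, h3]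
  -- §H THE DATUM: `δ₂ ≫ β 2 = 1` and `j ≫ δ₂ = e^p ≫ c 2` (powers push through the base-change square of `B[p²]`)
  refine ⟨δ₂, hβδ, ?_⟩
  have hpow2 := pow_left_comp_eq_of_sq wB2 hcη2 hcμ2 e
    (b := (X₀.torsion (p ^ 2)).hom ≫ Spec.map (CommRingCat.ofHom (Ideal.Quotient.mk J))) rfl t2 rfl p
  rw [← Over.comp_left, hjδ₂]
  exact hpow2.symm

end SerreTateKernel

end Literature.AlgebraicGeometry.GroupSchemes

end
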